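import Literature.AlgebraicGeometry.Morphisms.EqualizerLocusClosed
import HarnessLib

/-!
# «Two families of sections agree» is represented by ONE closed subscheme of the base

Topic `Literature/AlgebraicGeometry/Morphisms`; namespace `Literature.AlgebraicGeometry.Morphisms`.  THEOREMS ONLY (no definition, no named
fact, no instance, no notation, no `sorry`).  Sequel of ★ `EqualizerLocusClosed` (ONE pair of `S`-morphisms: the equaliser `Eq(f,g) ⊆ X` is a
closed subscheme when the target is separated, with its functor of points `exists_comp_equalizer_ι_eq_iff` ∕ `comp_eq_comp_iff_ker_equalizer_ι_le`).
Cell `hodgecm-mathlib` (D-0151), P6 «MOD programme» (crux hLiu418 = stmt-HodgeConjecture-24832), line-candidate `F0_P6a_IsomSchemeFiniteType`,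
sub-organ **(Ic)** of `stub_ICON` (A-p14 (g34) census `CENSUS-ICON-IsomConditionsLocus.v1` §2): the `Isom`-conditions «`u` preserves the unit
section» and «`u` carries the `2g` level sections `σ₁,ᵢ` to `σ₂,ᵢ`» are equalities of SECTIONS of (separated) abelian schemes over the pair
base.  HC_CM is proved only modulo the 2 remaining named inputs (hLiu418, h413) until rung 0 closes; generic, count-neutral.

## The mathematics

Let `(Xᵢ → S)_{i ∈ I}` be separated `S`-schemes (ANY index type `I`) and `σᵢ, σ′ᵢ : S → Xᵢ` sections.  For each `i` the equaliser
`Eq(σᵢ, σ′ᵢ) ⊆ S` is a closed subscheme with ideal `𝓘ᵢ` ([GortzWedhorn2020] Def.∕Prop. 9.7 (ii); Mathlib `isClosedImmersion_equalizer_ι_left`), and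
`u : T → S` satisfies `u ≫ σᵢ = u ≫ σ′ᵢ` iff `𝓘ᵢ ≤ ker u` (★).  Hence the closed subscheme `V(⨆ᵢ 𝓘ᵢ) ↪ S` (Mathlib `Scheme.IdealSheafData.subscheme`)
represents the conjunction: `u` factors through it iff `⨆ᵢ 𝓘ᵢ ≤ ker u` iff all `𝓘ᵢ ≤ ker u` — no finiteness of `I` needed (the lattice of ideal
sheaves is complete).  Reading through base change: `u ≫ σ = u ≫ σ′` is «the base-changed sections `σ ×_S T`, `σ′ ×_S T` of `X ×_S T → T`
coincide» ([GortzWedhorn2020] (4.7)).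

* **`exists_isClosedImmersion_forall_comp_eq_iff`** — the representing closed immersion `e : E ↪ S` with
  `(∀ i, u ≫ σᵢ = u ≫ σ′ᵢ) ↔ ∃ l, l ≫ e = u`.
* `comp_eq_of_comp_eq_of_exists_comp` — the conditions pass to any `T′ → T`.

## References
* [GortzWedhorn2020] U. Görtz, T. Wedhorn, *Algebraic Geometry I*, 2nd ed. (2020), Definition∕Proposition 9.7 (ii) (p. 233), Definition 9.1 (3)
  (p. 231), Section (4.7) (pp. 107–108).
* [StacksProject] The Stacks Project, Tag 01KM.
* [MumfordFogartyKirwan1994] D. Mumford, J. Fogarty, F. Kirwan, *Geometric Invariant Theory*, 3rd ed. (1994), Ch. 7 §2 Definition 7.2 (p. 129)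
  (level structures as sections).
-/

set_option autoImplicit false

noncomputable section

-- Mathlib's `Over`/pull-back API is stated across semireducible wrappers (`(𝟙_ (Over S)).left = S`).
set_option backward.isDefEq.respectTransparency false

universe u

open CategoryTheory CategoryTheory.Limits AlgebraicGeometry MonoidalCategory

namespace Literature.AlgebraicGeometry.Morphisms

variable {S : Scheme.{u}} {I : Type*} (X : I → Over S) [∀ i, IsSeparated (X i).hom]
  (σ σ' : ∀ i, 𝟙_ (Over S) ⟶ X i)

/-- **«All the sections `σᵢ` and `σ′ᵢ` agree» is represented by ONE closed subscheme of `S`** (any index type): there is a closed immersion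
`e : E ↪ S` such that for every `u : T → S`, `u ≫ σᵢ = u ≫ σ′ᵢ` for all `i` iff `u` factors through `e` (the closed subscheme of the ideal
`⨆ᵢ 𝓘_{Eq(σᵢ, σ′ᵢ)}`; each equaliser is closed because `Xᵢ → S` is separated, Mathlib `isClosedImmersion_equalizer_ι_left`, ★
`comp_eq_comp_iff_ker_equalizer_ι_le`). [cite: GortzWedhorn2020, Definition 9.7 (ii) (p. 233) and Definition 9.1 (3) (p. 231)] [cite: StacksProject, Tag 01KM] -/
theorem exists_isClosedImmersion_forall_comp_eq_iff :
    ∃ (E : Scheme.{u}) (e : E ⟶ S) (_ : IsClosedImmersion e),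
      ∀ ⦃T : Scheme.{u}⦄ (u : T ⟶ S), (∀ i, u ≫ (σ i).left = u ≫ (σ' i).left) ↔ ∃ l : T ⟶ E, l ≫ e = u := by
  let J : S.IdealSheafData := ⨆ i, (equalizer.ι (σ i) (σ' i)).left.ker
  refine ⟨J.subscheme, J.subschemeι, inferInstance, fun T u => ⟨fun h => ?_, ?_⟩⟩
  · have hle : J ≤ u.ker := iSup_le fun i => (comp_eq_comp_iff_ker_equalizer_ι_le (σ i) (σ' i) u).1 (h i)
    have hle' : J.subschemeι.ker ≤ u.ker := by rwa [Scheme.IdealSheafData.ker_subschemeι]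
    exact ⟨IsClosedImmersion.lift J.subschemeι u hle', IsClosedImmersion.lift_fac _ _ _⟩
  · rintro ⟨l, rfl⟩ i
    refine (comp_eq_comp_iff_ker_equalizer_ι_le (σ i) (σ' i) (l ≫ J.subschemeι)).2 ?_
    calc (equalizer.ι (σ i) (σ' i)).left.ker ≤ J := le_iSup (fun i => (equalizer.ι (σ i) (σ' i)).left.ker) i
      _ = J.subschemeι.ker := (Scheme.IdealSheafData.ker_subschemeι J).symm
      _ ≤ (l ≫ J.subschemeι).ker := Scheme.Hom.le_ker_comp _ _

omit [∀ i, IsSeparated (X i).hom] in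
/-- The conditions pass to any further base change `T′ → T` (trivial associativity bookkeeping, recorded for the consumer).
[cite: GortzWedhorn2020, Section (4.7) (pp. 107–108)] -/
theorem comp_eq_of_comp_eq_of_exists_comp {T T' : Scheme.{u}} (u : T ⟶ S) (c : T' ⟶ T)
    (h : ∀ i, u ≫ (σ i).left = u ≫ (σ' i).left) : ∀ i, (c ≫ u) ≫ (σ i).left = (c ≫ u) ≫ (σ' i).left :=
  fun i => by rw [Category.assoc, Category.assoc, h i]

end Literature.AlgebraicGeometry.Morphisms

end
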